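import Mathlib
import Summits.MatrixMultiplication.MatrixMultiplication.Theorems.SubgroupIdentityDesigns.Negative.PfreeAlgebra

/-!
# The action of `GL₂(𝔽_p)` on the projective line over an algebraic closure

Route `LevelGradedCohnUmans`, crux `SubgroupIdentityDesigns` (stmt-MatrixMultiplication-14079), cell
`(m,k) = (2,1)`.  VALUE = THEOREM (elementary), NOT summit progress.  Second file of the in-Lean
proof of the named hypothesis `DicksonList` (`DicksonReduction.lean`).

`GL₂(𝔽_p)` acts on `PL p := ℙ(K̄²)`, `K̄ = AlgebraicClosure (ZMod p)`, through base change
(`plAction`, `smul_mk`); scalars act trivially and only scalars do (`smul_eq_self_of_mem_range`,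
`mem_range_scalarHom_of_forall_smul`).  The eigenline analysis is in `EigenLines.lean`.
-/

set_option linter.dupNamespace false

noncomputable section

open scoped BigOperators Classical

open Summit.MatrixMultiplication.MatrixMultiplication.Theorems.LieRankDesigns.Negative (GLm Mat)

namespace Summit.MatrixMultiplication.MatrixMultiplication.Theorems.SubgroupIdentityDesigns.Negative

section ProjectiveLineAction

variable {p : ℕ} [hp : Fact p.Prime]

/-- An algebraic closure of `𝔽_p`. -/
abbrev Kb (p : ℕ) [Fact p.Prime] : Type := AlgebraicClosure (ZMod p)

/-- The projective line over `Kb p`. -/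
abbrev PL (p : ℕ) [Fact p.Prime] : Type := Projectivization (Kb p) (Fin 2 → Kb p)

/-- The embedding `𝔽_p → K̄`. -/
abbrev ιK (p : ℕ) [Fact p.Prime] : ZMod p →+* Kb p := algebraMap (ZMod p) (Kb p)

/-- `𝔽_p → K̄` is injective. -/
theorem ιK_injective : Function.Injective (ιK p) := (ιK p).injective

/-- Base change of `g ∈ GL₂(𝔽_p)` to `K̄`. -/
def gK (g : GLm p 2) : Matrix (Fin 2) (Fin 2) (Kb p) := (g : Mat p 2).map (ιK p)

/-- Entries of the base change. -/
@[simp] theorem gK_apply (g : GLm p 2) (i j : Fin 2) : gK g i j = ιK p ((g : Mat p 2) i j) := rfl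

/-- `gK 1 = 1`. -/
theorem gK_one : gK (1 : GLm p 2) = 1 := by
  ext i j; fin_cases i <;> fin_cases j <;> simp [gK_apply, gl2_one_apply]

/-- `gK` is multiplicative. -/
theorem gK_mul (g h : GLm p 2) : gK (g * h) = gK g * gK h := by
  unfold gK; rw [Units.val_mul, Matrix.map_mul]

/-- `gK g⁻¹ · gK g = 1`. -/
theorem gK_inv_mul (g : GLm p 2) : gK g⁻¹ * gK g = 1 := by rw [← gK_mul, inv_mul_cancel, gK_one]

/-- `gK g` does not kill non-zero vectors. -/
theorem gK_mulVec_ne_zero (g : GLm p 2) {v : Fin 2 → Kb p} (hv : v ≠ 0) : (gK g).mulVec v ≠ 0 := by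
  intro h
  apply hv
  have := congrArg ((gK g⁻¹).mulVec) h
  rwa [Matrix.mulVec_mulVec, gK_inv_mul, Matrix.one_mulVec, Matrix.mulVec_zero] at this

/-- `gK g` acts injectively. -/
theorem gK_mulVecLin_injective (g : GLm p 2) : Function.Injective (Matrix.mulVecLin (gK g)) := by
  intro v w hvw
  have h := congrArg ((gK g⁻¹).mulVec) hvw
  simp only [Matrix.mulVecLin_apply, Matrix.mulVec_mulVec, gK_inv_mul, Matrix.one_mulVec] at h
  exact h

/-- Two presentations of the same vector give the same point. -/
theorem mk_congr' {v w : Fin 2 → Kb p} (h : v = w) (hv : v ≠ 0) (hw : w ≠ 0) :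
    Projectivization.mk (Kb p) v hv = Projectivization.mk (Kb p) w hw := by subst h; rfl

/-- The action map. -/
def smulPL (g : GLm p 2) (x : PL p) : PL p :=
  x.map (Matrix.mulVecLin (gK g)) (gK_mulVecLin_injective g)

/-- The action on representatives. -/
theorem smulPL_mk (g : GLm p 2) (v : Fin 2 → Kb p) (hv : v ≠ 0) :
    smulPL g (Projectivization.mk (Kb p) v hv) =
      Projectivization.mk (Kb p) ((gK g).mulVec v) (gK_mulVec_ne_zero g hv) := rfl

/-- `1` acts trivially. -/
theorem smulPL_one (x : PL p) : smulPL 1 x = x := by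
  induction x using Projectivization.ind with
  | h v hv => rw [smulPL_mk]; exact mk_congr' (by rw [gK_one, Matrix.one_mulVec]) _ _

/-- Compatibility with multiplication. -/
theorem smulPL_mul (g h : GLm p 2) (x : PL p) : smulPL (g * h) x = smulPL g (smulPL h x) := by
  induction x using Projectivization.ind with
  | h v hv =>
    simp only [smulPL_mk]
    exact mk_congr' (by rw [gK_mul, Matrix.mulVec_mulVec]) _ _

/-- **The action of `GL₂(𝔽_p)` on the projective line over `K̄`.** -/
instance plAction : MulAction (GLm p 2) (PL p) where
  smul := smulPL
  one_smul := smulPL_one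
  mul_smul := smulPL_mul

/-- The action on representatives. -/
theorem smul_mk (g : GLm p 2) (v : Fin 2 → Kb p) (hv : v ≠ 0) :
    g • Projectivization.mk (Kb p) v hv =
      Projectivization.mk (Kb p) ((gK g).mulVec v) (gK_mulVec_ne_zero g hv) := rfl

/-- `g • [v] = [w]` iff `g v` is a multiple of `w`. -/
theorem smul_mk_eq_mk_iff (g : GLm p 2) {v w : Fin 2 → Kb p} (hv : v ≠ 0) (hw : w ≠ 0) :
    g • Projectivization.mk (Kb p) v hv = Projectivization.mk (Kb p) w hw ↔
      ∃ a : Kb p, a • w = (gK g).mulVec v := by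
  rw [smul_mk, Projectivization.mk_eq_mk_iff']

/-- Base change of a scalar matrix. -/
theorem gK_scalarHom (u : (ZMod p)ˣ) :
    gK (scalarHom p 2 u) = (ιK p (u : ZMod p)) • (1 : Matrix (Fin 2) (Fin 2) (Kb p)) := by
  obtain ⟨h00, h01, h10, h11⟩ := scalarHom_entries (p := p) u
  ext i j; fin_cases i <;> fin_cases j <;> simp [gK_apply, h00, h01, h10, h11]

/-- **Scalars act trivially.** -/
theorem smul_eq_self_of_mem_range {g : GLm p 2} (hg : g ∈ (scalarHom p 2).range) (x : PL p) :
    g • x = x := by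
  obtain ⟨u, rfl⟩ := hg
  induction x using Projectivization.ind with
  | h v hv =>
    rw [smul_mk_eq_mk_iff]
    exact ⟨ιK p (u : ZMod p), by rw [gK_scalarHom, Matrix.smul_mulVec, Matrix.one_mulVec]⟩

/-- **Only scalars act trivially.** -/
theorem mem_range_scalarHom_of_forall_smul {g : GLm p 2} (h : ∀ x : PL p, g • x = x) :
    g ∈ (scalarHom p 2).range := by
  have e0 : (Pi.single 0 1 : Fin 2 → Kb p) ≠ 0 := by
    intro h0; have := congrFun h0 0; simp at this
  have e1 : (Pi.single 1 1 : Fin 2 → Kb p) ≠ 0 := by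
    intro h0; have := congrFun h0 1; simp at this
  have e2 : (fun _ => 1 : Fin 2 → Kb p) ≠ 0 := by
    intro h0; have := congrFun h0 0; simp at this
  obtain ⟨a, ha⟩ := (smul_mk_eq_mk_iff g e0 e0).mp (h _)
  obtain ⟨b, hb⟩ := (smul_mk_eq_mk_iff g e1 e1).mp (h _)
  obtain ⟨c, hc⟩ := (smul_mk_eq_mk_iff g e2 e2).mp (h _)
  have ha1 := congrFun ha 1
  have hb0 := congrFun hb 0
  have hc0 := congrFun hc 0
  have hc1 := congrFun hc 1
  simp [Matrix.mulVec, dotProduct, Fin.sum_univ_two] at ha1 hb0 hc0 hc1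
  rw [mem_range_scalarHom_iff]
  have h01 : (g : Mat p 2) 0 1 = 0 := ιK_injective (by rw [map_zero]; exact hb0.symm)
  have h10 : (g : Mat p 2) 1 0 = 0 := ιK_injective (by rw [map_zero]; exact ha1.symm)
  refine ⟨h01, h10, ιK_injective ?_⟩
  rw [h01, map_zero, add_zero] at hc0
  rw [h10, map_zero, zero_add] at hc1
  rw [← hc0, ← hc1]

end ProjectiveLineAction

end Summit.MatrixMultiplication.MatrixMultiplication.Theorems.SubgroupIdentityDesigns.Negative

end
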